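import Summits.Ventures.PercRepro.Night2GoodTwoD2Main

/-!
# night-2: floors of the capacity `cap3` by the coloop type of a target, and the size-only mass bound of the basis
pairs (building blocks of the basis pairs' fair share, cell `(2, 1)`, at most one fat closure)

* `L1_le_of_fatClosures_le_one`: the thin faces of `S` are erasures of the coloops of `S ∖ K` with pairwise distinct
  closures, so at most one of them is fat: `L1 S ≤ 7/120 + |coloops (S ∖ K)| · 7/30`.
* Floors of `cap3 = cap2 − dload` (`dsh = dshGT2`): `31/360` at a target with exactly two coloops off `K` (no load
  there), `23/72` at a target with at most one coloop and no load, `11/18` without coloops and without load, `1` when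
  `|G ∖ S| ≤ 1` (then no pair loads `S` at all).
* `pi2MassH_le_basis_count`: the mass of the basis pairs at a target `T` is at most `5 · C(|T ∖ K|, 5) · (7/24)/D`,
  `D = 2^(|G| − 6) − 1` the common number of targets of a basis pair (every basis pair below `T` is a five-point subset of
  `T ∖ K` with one of its points marked, and loses at most `7/24`).
-/

namespace PercRepro.Shadow

open PercRepro.ThmH PercRepro.PerFlat

variable {α : Type*} [DecidableEq α] {M : Matroid α} [M.Finite] {G : Finset α}

/-- Two thin faces of `S` at distinct coloops of `S ∖ K` have distinct closures. -/
theorem clF_erase_ne_of_coloops (hG : G ∈ flatsQ M (5 + 1)) (hk : kColoops M G = 1) {S : Finset α}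
    (hSG : S ⊆ G) (hKS : coloops M G ⊆ S) {w w' : α}
    (hw' : w' ∈ coloops M (S \ coloops M G)) (hne : w ≠ w') : clF M (S.erase w) ≠ clF M (S.erase w') := by
  intro heq
  have hGg : G ⊆ gr M := (mem_flatsQ.1 hG).1
  have hw'S : w' ∈ S := (Finset.mem_sdiff.1 (mem_coloops.1 hw').1).1
  have h1 : w' ∈ clF M (S.erase w) :=
    subset_clF_of_subset_gr ((Finset.erase_subset _ _).trans (hSG.trans hGg)) (Finset.mem_erase.2 ⟨hne.symm, hw'S⟩)
  rw [heq] at h1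
  exact coloop_notMem_clF_erase hG hk hSG hKS hw' h1

/-- **`L1 S ≤ 7/120 + |coloops (S ∖ K)| · 7/30`** with at most one fat closure: the thin faces are erasures of the
coloops of `S ∖ K`, at most one of them is fat (`7/24`), the others request `≤ 7/30`. -/
theorem L1_le_of_fatClosures_le_one (hG : G ∈ flatsQ M (5 + 1)) (hd : (gr M \ G).card = 2)
    (hk : kColoops M G = 1) (hfat : (fatClosures M 5 G 2).card ≤ 1) {S : Finset α} (hSG : S ⊆ G)
    (hKS : coloops M G ⊆ S) :
    L1 M 5 G S ≤ 7 / 120 + ((coloops M (S \ coloops M G)).card : ℚ) * (7 / 30) := by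
  have hd' : (gr M \ G).card ≤ 5 := by omega
  unfold L1
  set 𝓕 := (coverPreimages M (Uq M (5 + 2) 5) G S).filter (fun F => F ∉ lay0 M 5 G) with h𝓕
  have hsub := thin_coverPreimages_subset_image_coloops hG hd' S
  have hthin : ∀ F ∈ 𝓕, F ∈ thinMembers M 5 G := by
    intro F hF
    rw [h𝓕, Finset.mem_filter, mem_coverPreimages] at hF
    exact mem_thinMembers.2 ⟨hF.1.1, hF.2⟩
  have hcard : 𝓕.card ≤ (coloops M (S \ coloops M G)).card :=
    (Finset.card_le_card hsub).trans Finset.card_image_le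
  set 𝓕f := 𝓕.filter (fun F => (G \ clF M F).card ≤ 2) with hf
  have hf1 : 𝓕f.card ≤ 1 := by
    have : 𝓕f.card ≤ (fatClosures M 5 G 2).card := by
      apply Finset.card_le_card_of_injOn (clF M)
      · intro F hF
        rw [Finset.mem_coe, Finset.mem_filter] at hF
        rw [Finset.mem_coe]
        unfold fatClosures
        exact Finset.mem_image_of_mem _ (Finset.mem_filter.2 ⟨hthin F hF.1, hF.2⟩)
      · intro F hF F' hF' heq
        rw [Finset.mem_coe, Finset.mem_filter] at hF hF'
        obtain ⟨w, -, rfl⟩ := Finset.mem_image.1 (hsub hF.1)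
        obtain ⟨w', hw', rfl⟩ := Finset.mem_image.1 (hsub hF'.1)
        by_contra hne
        have hne' : w ≠ w' := fun h => hne (h ▸ rfl)
        exact clF_erase_ne_of_coloops hG hk hSG hKS hw' hne' heq
    omega
  have hsplit : ∑ F ∈ 𝓕, req M 5 F =
      ∑ F ∈ 𝓕f, req M 5 F + ∑ F ∈ 𝓕.filter (fun F => ¬ (G \ clF M F).card ≤ 2), req M 5 F := by
    rw [hf, Finset.sum_filter_add_sum_filter_not]
  rw [hsplit]
  have h1 : ∑ F ∈ 𝓕f, req M 5 F ≤ 𝓕f.card • (7 / 24 : ℚ) :=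
    Finset.sum_le_card_nsmul _ _ _ (fun F hF => req_le_seven_div_24_of_thin hG hd (hthin F (Finset.mem_filter.1 hF).1))
  have h2 : ∑ F ∈ 𝓕.filter (fun F => ¬ (G \ clF M F).card ≤ 2), req M 5 F ≤
      (𝓕.filter (fun F => ¬ (G \ clF M F).card ≤ 2)).card • (7 / 30 : ℚ) :=
    Finset.sum_le_card_nsmul _ _ _ (fun F hF => req_le_seven_thirtieths_of_not_fat hG hd
      (hthin F (Finset.mem_filter.1 hF).1) (Finset.mem_filter.1 hF).2)
  have hcards : 𝓕f.card + (𝓕.filter (fun F => ¬ (G \ clF M F).card ≤ 2)).card = 𝓕.card := by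
    rw [hf]
    exact Finset.card_filter_add_card_filter_not _
  rw [nsmul_eq_mul] at h1 h2
  have ha : (𝓕f.card : ℚ) ≤ 1 := by exact_mod_cast hf1
  have hab : (𝓕f.card : ℚ) + ((𝓕.filter (fun F => ¬ (G \ clF M F).card ≤ 2)).card : ℚ) ≤
      ((coloops M (S \ coloops M G)).card : ℚ) := by
    rw [← Nat.cast_add, hcards]
    exact_mod_cast hcard
  have hb0 : (0 : ℚ) ≤ ((𝓕.filter (fun F => ¬ (G \ clF M F).card ≤ 2)).card : ℚ) := Nat.cast_nonneg _
  have ha0 : (0 : ℚ) ≤ (𝓕f.card : ℚ) := Nat.cast_nonneg _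
  linarith

/-- **Floor `31/360` of `cap2` at a target with exactly two coloops off `K`** (at most one fat closure). -/
theorem cap2_ge_of_card_coloops_eq_two (hG : G ∈ flatsQ M (5 + 1)) (hd : (gr M \ G).card = 2)
    (hk : kColoops M G = 1) (hfat : (fatClosures M 5 G 2).card ≤ 1) {S : Finset α} (hSG : S ⊆ G)
    (hKS : coloops M G ⊆ S) (hc : (coloops M (S \ coloops M G)).card = 2) : 31 / 360 ≤ cap2 M 5 G S := by
  have hd' : (gr M \ G).card ≤ 5 := by omega
  have h1 := L1_le_of_fatClosures_le_one hG hd hk hfat hSG hKS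
  rw [hc] at h1
  have h2 := capS_ge_eleven_eighteenths_two_one hd hk hSG
  have h3 := cap2_ge_capS_sub_L1_of_le hG hd' S
  push_cast at h1
  linarith

/-- At a target with at least two coloops off `K` the `dshGT2` load vanishes: `cap3 = cap2`. -/
theorem cap3_gt2_eq_cap2_of_two_le_card_coloops (hG : G ∈ flatsQ M (5 + 1)) (hd : (gr M \ G).card = 2)
    (hk : kColoops M G = 1) (hs : ∀ e ∈ gr M, ∀ f ∈ gr M, e ≠ f → rkN M {e, f} = 2)
    (hl : ∀ e ∈ gr M, M.Indep {e}) {S : Finset α} (hc : 2 ≤ (coloops M (S \ coloops M G)).card) :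
    cap3 M 5 G (bigP M G) (dshGT2 M 5 G) S = cap2 M 5 G S := by
  unfold cap3
  rw [dload_gt2_eq_zero_of_two_le_card_coloops hG hd hk hs hl hc, sub_zero]

/-- **Floor `31/360` of `cap3` at a target with exactly two coloops off `K`.** -/
theorem cap3_gt2_ge_of_card_coloops_eq_two (hG : G ∈ flatsQ M (5 + 1)) (hd : (gr M \ G).card = 2)
    (hk : kColoops M G = 1) (hs : ∀ e ∈ gr M, ∀ f ∈ gr M, e ≠ f → rkN M {e, f} = 2)
    (hl : ∀ e ∈ gr M, M.Indep {e}) (hfat : (fatClosures M 5 G 2).card ≤ 1) {S : Finset α} (hSG : S ⊆ G)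
    (hKS : coloops M G ⊆ S) (hc : (coloops M (S \ coloops M G)).card = 2) :
    31 / 360 ≤ cap3 M 5 G (bigP M G) (dshGT2 M 5 G) S := by
  rw [cap3_gt2_eq_cap2_of_two_le_card_coloops hG hd hk hs hl (by omega)]
  exact cap2_ge_of_card_coloops_eq_two hG hd hk hfat hSG hKS hc

/-- **Floor `23/72` of `cap3` at an unloaded target with at most one coloop off `K`.** -/
theorem cap3_ge_of_card_coloops_le_one_of_dload_eq_zero (hG : G ∈ flatsQ M (5 + 1)) (hd : (gr M \ G).card = 2)
    (hk : kColoops M G = 1) {S : Finset α} (hSG : S ⊆ G) (hc : (coloops M (S \ coloops M G)).card ≤ 1)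
    {P : Finset α → Prop} [DecidablePred P] {dsh : Finset α → α → Finset α → ℚ} (h0 : dload M 5 G P dsh S = 0) :
    23 / 72 ≤ cap3 M 5 G P dsh S := by
  have hd' : (gr M \ G).card ≤ 5 := by omega
  unfold cap3
  rw [h0, sub_zero]
  have h1 := L1_le_of_card_coloops_le_one hG hd hc
  have h2 := capS_ge_eleven_eighteenths_two_one hd hk hSG
  have h3 := cap2_ge_capS_sub_L1_of_le hG hd' S
  linarith

/-- **Floor `11/18` of `cap3` at an unloaded target without coloops off `K`.** -/
theorem cap3_ge_of_coloops_eq_empty_of_dload_eq_zero (hG : G ∈ flatsQ M (5 + 1)) (hd : (gr M \ G).card = 2)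
    (hk : kColoops M G = 1) {S : Finset α} (hSG : S ⊆ G) (hc : coloops M (S \ coloops M G) = ∅)
    {P : Finset α → Prop} [DecidablePred P] {dsh : Finset α → α → Finset α → ℚ} (h0 : dload M 5 G P dsh S = 0) :
    11 / 18 ≤ cap3 M 5 G P dsh S := by
  have hd' : (gr M \ G).card ≤ 5 := by omega
  unfold cap3
  rw [h0, sub_zero]
  have h1 := L1_le_card_coloops_mul hG hd S
  rw [hc, Finset.card_empty] at h1
  have h2 := capS_ge_eleven_eighteenths_two_one hd hk hSG
  have h3 := cap2_ge_capS_sub_L1_of_le hG hd' S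
  push_cast at h1
  linarith

/-- `cap2 = 1` when at most three points of `G` are off `S` (cell `(2, ·)`). -/
theorem cap2_eq_one_of_card_sdiff_le_three (hG : G ∈ flatsQ M (5 + 1)) (hd : (gr M \ G).card = 2)
    {S : Finset α} (h : (G \ S).card ≤ 3) : cap2 M 5 G S = 1 :=
  cap2_eq_one_of_card_le hG (by omega)

/-- A thin member leaves at least five points of `G` outside it (`|gr ∖ B| ≥ 7` since `gr ∖ B` has rank `7`). -/
theorem five_le_card_sdiff_of_mem_thinMembers (hG : G ∈ flatsQ M (5 + 1)) (hd : (gr M \ G).card = 2)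
    {B : Finset α} (hB : B ∈ thinMembers M 5 G) : 5 ≤ (G \ B).card := by
  have hGg : G ⊆ gr M := (mem_flatsQ.1 hG).1
  have hU := (mem_membersIn.1 (mem_thinMembers.1 hB).1).1
  have h7 : rkN M (gr M \ B) = 7 := by
    have := (mem_Uq.1 hU).2.2
    rw [eRk_eq_rkN] at this
    exact_mod_cast this
  have hle := rkN_le_card (M := M) (gr M \ B)
  have hBG : B ⊆ G := subset_G_of_mem_thinMembers hB
  -- `gr ∖ B = (G ∖ B) ∪ (gr ∖ G)`
  have hsplit : (gr M \ B).card = (G \ B).card + (gr M \ G).card := by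
    have hdisj : Disjoint (G \ B) (gr M \ G) := by
      rw [Finset.disjoint_left]
      intro a ha hb
      exact (Finset.mem_sdiff.1 hb).2 (Finset.mem_sdiff.1 ha).1
    rw [← Finset.card_union_of_disjoint hdisj]
    congr 1
    ext a
    simp only [Finset.mem_sdiff, Finset.mem_union]
    constructor
    · intro ⟨hag, haB⟩
      by_cases haG : a ∈ G
      · exact Or.inl ⟨haG, haB⟩
      · exact Or.inr ⟨hag, haG⟩
    · rintro (⟨haG, haB⟩ | ⟨hag, haG⟩)
      · exact ⟨hGg haG, haB⟩
      · exact ⟨hag, fun hB' => haG (hBG hB')⟩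
  omega

/-- **No pair loads a target with at most one point of `G` outside it** under `dshGT2`: every share goes to a set
`insert z B` plus one or two points, and `|G ∖ insert z B| ≥ 4`. -/
theorem dshGT2_eq_zero_of_card_sdiff_le_one (hG : G ∈ flatsQ M (5 + 1)) (hd : (gr M \ G).card = 2)
    {B : Finset α} (hB : B ∈ thinMembers M 5 G) {z : α} (hz : z ∈ G \ clF M B) {S : Finset α}
    (hS : (G \ S).card ≤ 1) : dshGT2 M 5 G B z S = 0 := by
  have hGg : G ⊆ gr M := (mem_flatsQ.1 hG).1
  have hBG : B ⊆ G := subset_G_of_mem_thinMembers hB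
  have h5 := five_le_card_sdiff_of_mem_thinMembers hG hd hB
  have hzG : z ∈ G := (Finset.mem_sdiff.1 hz).1
  have hzB : z ∉ B := fun h => (Finset.mem_sdiff.1 hz).2 (subset_clF_of_subset_gr (hBG.trans hGg) h)
  have hQ : (G \ insert z B).card + 1 = (G \ B).card := by
    rw [Finset.sdiff_insert, Finset.card_erase_of_mem (Finset.mem_sdiff.2 ⟨hzG, hzB⟩)]
    have := Finset.card_pos.2 ⟨z, Finset.mem_sdiff.2 ⟨hzG, hzB⟩⟩
    omega
  -- removing a point from `G ∖ Y` costs at most one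
  have hstep : ∀ (Y : Finset α) (x : α), (G \ Y).card ≤ (G \ insert x Y).card + 1 := by
    intro Y x
    have h1 := Finset.card_le_card (show (G \ Y).erase x ⊆ G \ insert x Y from by
      intro a ha
      rw [Finset.mem_erase, Finset.mem_sdiff] at ha
      rw [Finset.mem_sdiff, Finset.mem_insert]
      exact ⟨ha.2.1, fun h => h.elim ha.1 ha.2.2⟩)
    have h2 := Finset.pred_card_le_card_erase (s := G \ Y) (a := x)
    omega
  have hins : ∀ x, 3 ≤ (G \ insert x (insert z B)).card := by
    intro x
    have := hstep (insert z B) x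
    omega
  have hins2 : ∀ x x', 2 ≤ (G \ insert x (insert x' (insert z B))).card := by
    intro x x'
    have := hstep (insert x' (insert z B)) x
    have := hins x'
    omega
  by_contra hne
  unfold dshGT2 dshMissed at hne
  split_ifs at hne with h1 h2 h3 h4 h5'
  · -- good target
    unfold gtTargets at h2
    rw [Finset.mem_image] at h2
    obtain ⟨x, -, rfl⟩ := h2
    have := hins x
    omega
  · exact hne rfl
  · -- distance-2 target
    obtain ⟨p, -, rfl⟩ := mem_d2Targets.1 h4
    have := hins2 p.1 p.2
    omega
  · exact hne rfl
  · obtain ⟨x, -, -, rfl⟩ := mem_missedTargets.1 h5'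
    have := hins x
    omega
  · exact hne rfl

/-- **The `dshGT2` load vanishes at a target with at most one point of `G` outside it.** -/
theorem dload_gt2_eq_zero_of_card_sdiff_le_one (hG : G ∈ flatsQ M (5 + 1)) (hd : (gr M \ G).card = 2)
    {S : Finset α} (hS : (G \ S).card ≤ 1) : dload M 5 G (bigP M G) (dshGT2 M 5 G) S = 0 := by
  unfold dload
  apply Finset.sum_eq_zero
  intro B hB
  apply Finset.sum_eq_zero
  intro z hz
  exact dshGT2_eq_zero_of_card_sdiff_le_one hG hd (Finset.mem_filter.1 hB).1 hz hS

/-- **`cap3 = 1` at a target with at most one point of `G` outside it.** -/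
theorem cap3_gt2_eq_one_of_card_sdiff_le_one (hG : G ∈ flatsQ M (5 + 1)) (hd : (gr M \ G).card = 2)
    {S : Finset α} (hS : (G \ S).card ≤ 1) : cap3 M 5 G (bigP M G) (dshGT2 M 5 G) S = 1 := by
  unfold cap3
  rw [dload_gt2_eq_zero_of_card_sdiff_le_one hG hd hS, cap2_eq_one_of_card_sdiff_le_three hG hd (by omega), sub_zero]

/-- A basis pair: a thin member with four points off `K`. -/
theorem card_sdiff_eq_four_of_not_bigP (hG : G ∈ flatsQ M (5 + 1)) (hd : (gr M \ G).card = 2)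
    (hk : kColoops M G = 1) {B : Finset α} (hB : B ∈ thinMembers M 5 G) (hnP : ¬ bigP M G B) :
    (B \ coloops M G).card = 4 := by
  have hd' : (gr M \ G).card ≤ 5 := by omega
  have := card_sdiff_coloops_thin_ge hG hd' (show kColoops M G + 5 = 5 + 1 by omega) hB
  unfold bigP at hnP
  omega

/-- The loss of a pair is at most the request of its member: `loss = req · (1 − fS)` with `0 ≤ fS ≤ 1`. -/
theorem loss_le_seven_div_24 (hG : G ∈ flatsQ M (5 + 1)) (hd : (gr M \ G).card = 2) (hk : kColoops M G = 1)
    {B : Finset α} (hB : B ∈ thinMembers M 5 G) {z : α} (hz : z ∈ G \ clF M B) :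
    loss M 5 G B z ≤ 7 / 24 := by
  have hQG : insert z B ⊆ G := Finset.insert_subset (Finset.mem_sdiff.1 hz).1 (subset_G_of_mem_thinMembers hB)
  have hcap : 0 ≤ capS M 5 G (insert z B) :=
    le_trans (by norm_num) (capS_ge_eleven_eighteenths_two_one hd hk hQG)
  have hf0 := fS_nonneg (M := M) (q := 5) (G := G) (S := insert z B) hcap
  have hf1 := fS_le_one (M := M) (q := 5) (G := G) (S := insert z B) hcap
  have hreq := req_le_seven_div_24_of_thin hG hd hB
  have hreq0 : 0 ≤ req M 5 B := by
    unfold req phiQ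
    positivity
  unfold loss
  nlinarith

/-- **The size-only mass bound**: the basis pairs' mass at `T` is at most `5 · C(|T ∖ K|, 5) · (7/24) / D`,
`D = 2^(|G| − 6) − 1` the number of targets of every basis pair. -/
theorem pi2MassH_le_basis_count (hG : G ∈ flatsQ M (5 + 1)) (hd : (gr M \ G).card = 2)
    (hk : kColoops M G = 1) (T : Finset α) :
    pi2MassH M 5 G (bigP M G) T ≤
      ((5 * (T \ coloops M G).card.choose 5 : ℕ) : ℚ) * ((7 / 24) / ((2 ^ (G.card - 6) - 1 : ℕ) : ℚ)) := by
  have hd' : (gr M \ G).card ≤ 5 := by omega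
  have hGg : G ⊆ gr M := (mem_flatsQ.1 hG).1
  set D : ℚ := ((2 ^ (G.card - 6) - 1 : ℕ) : ℚ) with hD
  set c : ℚ := (7 / 24) / D with hc
  -- each `rhoL` of a basis pair is at most `c`
  have hrho : ∀ B ∈ thinMembers M 5 G, ¬ bigP M G B → ∀ z ∈ G \ clF M B, rhoL M 5 G B z ≤ c := by
    intro B hB hnP z hz
    have hB4 := card_sdiff_eq_four_of_not_bigP hG hd hk hB hnP
    unfold rhoL
    rw [card_tgtSets hG (mem_thinMembers.1 hB).1 hz,
      card_sdiff_insert_eq_dqm1 (ρ := 5) hG hd' hB (by omega) hz, hk]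
    have hcard : G.card - 1 - 5 = G.card - 6 := by omega
    rw [hcard, hc, hD]
    by_cases hD0 : ((2 ^ (G.card - 6) - 1 : ℕ) : ℚ) = 0
    · rw [hD0, div_zero, div_zero]
    · have hDpos : (0 : ℚ) < ((2 ^ (G.card - 6) - 1 : ℕ) : ℚ) := lt_of_le_of_ne (Nat.cast_nonneg _) (Ne.symm hD0)
      exact div_le_div_of_nonneg_right (loss_le_seven_div_24 hG hd hk hB hz) hDpos.le
  -- the pairs below `T`
  set PP := (((thinMembers M 5 G).filter (fun B => ¬ bigP M G B)).sigma (fun B => G \ clF M B)).filter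
    (fun p => T ∈ tgtSets M 5 G p.1 p.2) with hPP
  have hmass : pi2MassH M 5 G (bigP M G) T = ∑ p ∈ PP, rhoL M 5 G p.1 p.2 := by
    rw [hPP, Finset.sum_filter, Finset.sum_sigma]
    unfold pi2MassH
    rw [Finset.sum_filter]
  have hle : ∑ p ∈ PP, rhoL M 5 G p.1 p.2 ≤ PP.card • c := by
    apply Finset.sum_le_card_nsmul
    intro p hp
    rw [hPP, Finset.mem_filter, Finset.mem_sigma, Finset.mem_filter] at hp
    exact hrho p.1 hp.1.1.1 hp.1.1.2 p.2 hp.1.2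
  -- the pairs inject into the marked five-point subsets of `T ∖ K`
  have hcount : PP.card ≤ (((T \ coloops M G).powersetCard 5).sigma (fun Q => Q)).card := by
    apply Finset.card_le_card_of_injOn (fun p => (⟨insert p.2 p.1 \ coloops M G, p.2⟩ : Σ _ : Finset α, α))
    · intro p hp
      rw [Finset.mem_coe, hPP, Finset.mem_filter, Finset.mem_sigma, Finset.mem_filter] at hp
      obtain ⟨⟨⟨hB, hnP⟩, hz⟩, hT⟩ := hp
      have hB4 := card_sdiff_eq_four_of_not_bigP hG hd hk hB hnP
      have hzB : p.2 ∉ p.1 := fun h => (Finset.mem_sdiff.1 hz).2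
        (subset_clF_of_subset_gr ((subset_G_of_mem_thinMembers hB).trans hGg) h)
      have hzK : p.2 ∉ coloops M G := fun h => hzB (coloops_subset_of_mem_thinMembers hG hd' hB h)
      have hQT : insert p.2 p.1 ⊆ T := (mem_tgtSets.1 hT).2.1
      rw [Finset.mem_coe, Finset.mem_sigma, Finset.mem_powersetCard]
      show (insert p.2 p.1 \ coloops M G ⊆ T \ coloops M G ∧ (insert p.2 p.1 \ coloops M G).card = 5) ∧
        p.2 ∈ insert p.2 p.1 \ coloops M G
      refine ⟨⟨fun a ha => ?_, ?_⟩, ?_⟩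
      · rw [Finset.mem_sdiff] at ha ⊢
        exact ⟨hQT ha.1, ha.2⟩
      · rw [Finset.insert_sdiff_of_notMem _ hzK, Finset.card_insert_of_notMem (fun h => hzB (Finset.mem_sdiff.1 h).1), hB4]
      · exact Finset.mem_sdiff.2 ⟨Finset.mem_insert_self _ _, hzK⟩
    · intro p hp p' hp' heq
      rw [Finset.mem_coe, hPP, Finset.mem_filter, Finset.mem_sigma, Finset.mem_filter] at hp hp'
      simp only [Sigma.mk.injEq] at heq
      obtain ⟨h1, h2⟩ := heq
      have h2' : p.2 = p'.2 := eq_of_heq h2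
      have hB := hp.1.1.1
      have hB' := hp'.1.1.1
      have hKB : coloops M G ⊆ p.1 := coloops_subset_of_mem_thinMembers hG hd' hB
      have hKB' : coloops M G ⊆ p'.1 := coloops_subset_of_mem_thinMembers hG hd' hB'
      have hzB : p.2 ∉ p.1 := fun h => (Finset.mem_sdiff.1 hp.1.2).2
        (subset_clF_of_subset_gr ((subset_G_of_mem_thinMembers hB).trans hGg) h)
      have hzB' : p'.2 ∉ p'.1 := fun h => (Finset.mem_sdiff.1 hp'.1.2).2
        (subset_clF_of_subset_gr ((subset_G_of_mem_thinMembers hB').trans hGg) h)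
      have hzK : p.2 ∉ coloops M G := fun h => hzB (hKB h)
      have hzK' : p'.2 ∉ coloops M G := fun h => hzB' (hKB' h)
      rw [Finset.insert_sdiff_of_notMem _ hzK, Finset.insert_sdiff_of_notMem _ hzK', h2'] at h1
      have h3 : p.1 \ coloops M G = p'.1 \ coloops M G := by
        have := congrArg (fun s => s.erase p'.2) h1
        rwa [Finset.erase_insert (fun h => hzB (h2' ▸ (Finset.mem_sdiff.1 h).1)),
          Finset.erase_insert (fun h => hzB' (Finset.mem_sdiff.1 h).1)] at this
      have h4 : p.1 = p'.1 := by
        rw [← Finset.sdiff_union_of_subset hKB, ← Finset.sdiff_union_of_subset hKB', h3]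
      exact Sigma.ext h4 h2
  rw [hmass]
  refine hle.trans ?_
  rw [nsmul_eq_mul]
  rw [Finset.card_sigma] at hcount
  have hsum : ∑ Q ∈ (T \ coloops M G).powersetCard 5, Q.card = 5 * (T \ coloops M G).card.choose 5 := by
    rw [← Finset.card_powersetCard 5 (T \ coloops M G), mul_comm, ← smul_eq_mul, ← Finset.sum_const]
    apply Finset.sum_congr rfl
    intro Q hQ
    exact (Finset.mem_powersetCard.1 hQ).2
  rw [hsum] at hcount
  have hc0 : 0 ≤ c := by
    rw [hc]
    positivity
  calc (PP.card : ℚ) * c ≤ ((5 * (T \ coloops M G).card.choose 5 : ℕ) : ℚ) * c := by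
        gcongr
    _ = _ := by rw [hc]

end PercRepro.Shadow
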